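import Literature.IUT.HodgeTheaters.BaseHodgeTheaters
import HarnessLib

/-!
# Proofs for base-ΘNF-Hodge theaters: Propositions 4.7 (ii), (iii), 4.8 (iv) ([IUTchI] pp. 112–115) — abc-iut cell, layer L5

Mochizuki, *Inter-universal Teichmüller theory I*, §4. The statements `Prop47ii`, `Prop47iii` of `BaseHodgeTheaters.lean`
(existence and uniqueness of the global label class `[†ε] ∈ LabCusp(†𝒟^⊚)` whose pull-back along every
constituent of `†φ^NF_j` has label `†χ(j)`; the `†χ(j)`-twisted compatibility of the pull-backs along `†φ^NF_j` and
`†φ^NF_1`) are PROVED here for every `𝒟`-ΘNF-Hodge theater over any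
`BaseThetaDatum`, by transport from the model case (`labPull_of_mem_phiNFj`, `εLab`): this is the
"intrinsic nature of the constructions of Example 4.5" invoked in the printed proof of Proposition 4.7.
Also: in a `𝒟`-ΘNF-Hodge theater exhibited through model isomorphisms indexed by `ι : F_l^⋇ ⥲ J`, the labels
of Prop. 4.7 (i) are `†χ = ι⁻¹` (`DThetaBridge.χ_apply_of_isModel`); and Prop. 4.8 (iv) (every `𝒟`-NF-bridge
underlies a `𝒟`-ΘNF-Hodge theater) is PROVED (`prop48iv_holds`).
Record-only; [claim: Mochizuki2012, status: disputed]; nothing here takes a side.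
-/

namespace Literature.IUT.HodgeTheaters

open CategoryTheory

universe u

namespace BaseThetaDatum

variable {𝔡 : BaseThetaDatum.{u}}

/-- Transport of local label classes along the inverse isomorphism. [claim: Mochizuki2012, status: disputed] -/
theorem labIso_symm {v : 𝔡.V} {X Y : 𝔡.Amb v} (a : X ≅ Y) : 𝔡.labIso a.symm = (𝔡.labIso a).symm := by
  have h : (𝔡.labIso a).trans (𝔡.labIso a.symm) = Equiv.refl _ := by
    rw [← 𝔡.labIso_trans, Iso.self_symm_id, 𝔡.labIso_refl]
  ext c
  have := congrArg (fun e : 𝔡.LabCusp v X ≃ 𝔡.LabCusp v X => e ((𝔡.labIso a).symm c)) h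
  simpa using this

/-- In a `𝒟`-ΘNF-Hodge theater (indeed in its `𝒟`-Θ-bridge) exhibited through model isomorphisms indexed by
`ι : F_l^⋇ ⥲ J`, the label bijection of Prop. 4.7 (i) is `†χ = ι⁻¹`. [claim: Mochizuki2012, status: disputed] -/
theorem DThetaBridge.χ_apply_of_isModel (B : 𝔡.DThetaBridge) (ι : FlStar 𝔡.l ≃ B.J)
    (κ : ∀ j, 𝔡.tautStrip ≅ B.capsule (ι j)) (γ : 𝔡.tautStrip ≅ B.cod)
    (hΘ : ∀ j v, B.poly (ι j) v =
      {g | ∃ f ∈ 𝔡.modelThetaBridge j v, g = (Pi.isoApp (κ j) v).inv ≫ f ≫ (Pi.isoApp γ v).hom})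
    (j : FlStar 𝔡.l) : B.χ (ι j) = j := by
  obtain ⟨v, hv⟩ := 𝔡.exists_isBad
  have h := B.χ_unique hv (fun i => ι.symm i) (fun i f hf => by
    obtain ⟨j', rfl⟩ : ∃ j', i = ι j' := ⟨ι.symm i, by simp⟩
    rw [hΘ j' v] at hf
    obtain ⟨f₀, hf₀, rfl⟩ := hf
    rw [Equiv.symm_apply_apply]
    exact phiThetaAt_isoComp j' (Pi.isoApp (κ j') v).symm (phiThetaAt_compIso j' (Pi.isoApp γ v) hf₀))
  have := congrFun h (ι j)
  rw [Equiv.symm_apply_apply] at this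
  exact this.symm

/-- The pull-back of a global label class along a constituent of `†φ^NF_{ι(j)}` in a `𝒟`-ΘNF-Hodge theater
exhibited through model isomorphisms `(ι, κ, δ)`: `c ↦ (g · j) · η` where `δ⁻¹(c) = g · [ε]`.
[claim: Mochizuki2012, status: disputed] -/
theorem DThetaNFHodgeTheater.labPull_of_isModel (H : 𝔡.DThetaNFHodgeTheater) (ι : FlStar 𝔡.l ≃ H.J)
    (κ : ∀ j, 𝔡.tautStrip ≅ H.capsule (ι j)) (δ : 𝔡.DG ≅ H.glob)
    (hNF : ∀ j v, H.polyNF (ι j) v = PolyHomNF.conj 𝔡 (Pi.isoApp (κ j) v) δ (𝔡.phiNFj j v))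
    (j : FlStar 𝔡.l) (v : 𝔡.V) {f : 𝔡.HomNF v (H.capsule (ι j) v) H.glob} (hf : f ∈ H.polyNF (ι j) v)
    (g : FlStar 𝔡.l) :
    𝔡.labPull f (𝔡.labIsoG δ (g • 𝔡.εLab)) = (g * j) • 𝔡.η v (H.capsule (ι j) v) := by
  rw [hNF j v] at hf
  obtain ⟨f₀, hf₀, rfl⟩ := hf
  rw [𝔡.labPull_postNF, 𝔡.labPull_preNF, Equiv.symm_apply_apply, labPull_of_mem_phiNFj hf₀,
    labIso_symm, Equiv.symm_symm]
  change 𝔡.labIso (Pi.isoApp (κ j) v)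
      (((𝔡.isTorsor_labCuspG 𝔡.DG).labelEquiv 𝔡.εLab (g • 𝔡.εLab) * j) • 𝔡.η v (𝔡.D v)) = _
  rw [IsTorsor.labelEquiv_smul_self, 𝔡.labIso_smul, 𝔡.labIso_η]

/-- **Proposition 4.7 (iii) holds** for every `𝒟`-ΘNF-Hodge theater: there is a unique global label class
`[†ε] ∈ LabCusp(†𝒟^⊚)` whose pull-back along every constituent of every `†φ^NF_{j,v}` has label `†χ(j)` — namely
the transport of the model's `[ε]` along any exhibiting isomorphism `𝒟^⊚ ⥲ †𝒟^⊚`.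
[claim: Mochizuki2012, status: disputed] -/
theorem prop47iii_holds (H : 𝔡.DThetaNFHodgeTheater) : Prop47iii H := by
  obtain ⟨ι, κ, δ, γ, hNF, hΘ⟩ := H.isModel
  have hχ : ∀ j, H.toDThetaBridge.χ (ι j) = j :=
    DThetaBridge.χ_apply_of_isModel H.toDThetaBridge ι κ γ hΘ
  refine ⟨𝔡.labIsoG δ 𝔡.εLab, ?_, ?_⟩
  · intro j v f hf
    obtain ⟨j₀, rfl⟩ : ∃ j₀, j = ι j₀ := ⟨ι.symm j, by simp⟩
    have h1 := H.labPull_of_isModel ι κ δ hNF j₀ v hf 1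
    rw [one_smul, one_mul] at h1
    change (𝔡.isTorsor_labCusp v (H.capsule (ι j₀) v)).labelEquiv (𝔡.η v (H.capsule (ι j₀) v))
      (𝔡.labPull f (𝔡.labIsoG δ 𝔡.εLab)) = H.toDThetaBridge.χ (ι j₀)
    rw [h1, IsTorsor.labelEquiv_smul_self, hχ]
  · intro e' he'
    obtain ⟨v, -⟩ := 𝔡.exists_isBad
    obtain ⟨g, hg, -⟩ := (𝔡.isTorsor_labCuspG 𝔡.DG).existsUnique_smul_eq 𝔡.εLab ((𝔡.labIsoG δ).symm e')
    have he : e' = 𝔡.labIsoG δ (g • 𝔡.εLab) := by rw [hg, Equiv.apply_symm_apply]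
    -- a constituent of `†φ^NF_{ι(1)}` at `v`
    let f₀ : 𝔡.HomNF v (𝔡.D v) 𝔡.DG := 𝔡.postNF (𝔡.preNF (Iso.refl _) (𝔡.phiNF v)) (Iso.refl _)
    have hf₀ : f₀ ∈ 𝔡.phiNFj 1 v := (mem_phiNFj_iff f₀).2 ⟨Iso.refl _, Iso.refl _, autLabel_refl _, rfl⟩
    let f : 𝔡.HomNF v (H.capsule (ι 1) v) H.glob := 𝔡.postNF (𝔡.preNF (Pi.isoApp (κ 1) v).symm f₀) δ
    have hf : f ∈ H.polyNF (ι 1) v := by rw [hNF 1 v]; exact ⟨f₀, hf₀, rfl⟩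
    have h2 := he' (ι 1) v f hf
    change (𝔡.isTorsor_labCusp v (H.capsule (ι 1) v)).labelEquiv (𝔡.η v (H.capsule (ι 1) v))
      (𝔡.labPull f e') = H.toDThetaBridge.χ (ι 1) at h2
    rw [he, H.labPull_of_isModel ι κ δ hNF 1 v hf g, mul_one, IsTorsor.labelEquiv_smul_self, hχ] at h2
    rw [he, h2, one_smul]

/-- **Proposition 4.7 (ii) holds** for every `𝒟`-ΘNF-Hodge theater: all constituents of `†φ^NF_{j,v}` induce the
same pull-back of label classes, and — after the identification of Prop. 4.2 between the strips `†𝒟_j` and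
`†𝒟_1` — the pull-back along `†φ^NF_j` is the pull-back along `†φ^NF_1` precomposed with translation by `†χ(j)`.
[claim: Mochizuki2012, status: disputed] -/
theorem prop47ii_holds (H : 𝔡.DThetaNFHodgeTheater) : Prop47ii H := by
  obtain ⟨ι, κ, δ, γ, hNF, hΘ⟩ := H.isModel
  have hχ : ∀ j, H.toDThetaBridge.χ (ι j) = j :=
    DThetaBridge.χ_apply_of_isModel H.toDThetaBridge ι κ γ hΘ
  -- every global class is `δ (g · [ε])`
  have hc : ∀ c : 𝔡.LabCuspG H.glob, ∃ g : FlStar 𝔡.l, c = 𝔡.labIsoG δ (g • 𝔡.εLab) := fun c => by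
    obtain ⟨g, hg, -⟩ := (𝔡.isTorsor_labCuspG 𝔡.DG).existsUnique_smul_eq 𝔡.εLab ((𝔡.labIsoG δ).symm c)
    exact ⟨g, by rw [hg, Equiv.apply_symm_apply]⟩
  refine ⟨fun j v f f' hf hf' => ?_, fun j j₁ hj₁ v f f₁ hf hf₁ c => ?_⟩
  · obtain ⟨j₀, rfl⟩ : ∃ j₀, j = ι j₀ := ⟨ι.symm j, by simp⟩
    ext c
    obtain ⟨g, rfl⟩ := hc c
    rw [H.labPull_of_isModel ι κ δ hNF j₀ v hf g, H.labPull_of_isModel ι κ δ hNF j₀ v hf' g]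
  · obtain ⟨j₀, rfl⟩ : ∃ j₀, j = ι j₀ := ⟨ι.symm j, by simp⟩
    have hj₁' : j₁ = ι 1 := by
      apply H.toDThetaBridge.χ.injective
      rw [hχ 1]; exact hj₁
    subst hj₁'
    obtain ⟨g, rfl⟩ := hc c
    change DPrimeStrip.labCanon _ _ v _ = 𝔡.labPull f₁ (H.toDThetaBridge.χ (ι j₀) • _)
    rw [hχ, H.labPull_of_isModel ι κ δ hNF j₀ v hf g, ← 𝔡.labIsoG_smul, smul_smul,
      H.labPull_of_isModel ι κ δ hNF 1 v hf₁ (j₀ * g), mul_one, DPrimeStrip.labCanon,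
      IsTorsor.pointedEquiv_smul, IsTorsor.pointedEquiv_self]
    exact congrArg (· • _) (mul_comm g j₀)


/-- The model poly-morphism `φ^Θ_{v_j}` transported along isomorphisms `κ : 𝒟_v ⥲ X`, `γ : 𝒟_v ⥲ Y` is `φ^Θ_{v_j}` between
`X` and `Y` (iso-saturation, Example 4.4 (ii)/(iv)). [claim: Mochizuki2012, status: disputed] -/
theorem phiThetaAt_eq_conj (j : FlStar 𝔡.l) (v : 𝔡.V) {X Y : 𝔡.Amb v} (κ : 𝔡.D v ≅ X) (γ : 𝔡.D v ≅ Y) :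
    𝔡.phiThetaAt j v X Y = {g | ∃ f ∈ 𝔡.modelThetaBridge j v, g = κ.inv ≫ f ≫ γ.hom} := by
  ext g
  constructor
  · intro hg
    refine ⟨κ.hom ≫ g ≫ γ.inv, ?_, ?_⟩
    · exact phiThetaAt_isoComp j κ (phiThetaAt_compIso j γ.symm hg)
    · rw [Category.assoc, Category.assoc, Iso.inv_hom_id, Category.comp_id, Iso.inv_hom_id_assoc]
  · rintro ⟨f, hf, rfl⟩
    exact phiThetaAt_isoComp j κ.symm (phiThetaAt_compIso j γ hf)

/-- **Proposition 4.8 (iv) holds** (existence part): every `𝒟`-NF-bridge is the underlying `𝒟`-NF-bridge of some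
`𝒟`-ΘNF-Hodge theater — glue the model `𝒟`-Θ-bridge, transported to the given capsule through any model
isomorphism exhibiting the NF-bridge ("a relatively simple functorial algorithm", [IUTchI] p. 115; the
`F_l^⋇`-indeterminacy is the choice of that exhibiting isomorphism). [claim: Mochizuki2012, status: disputed] -/
theorem prop48iv_holds (B : 𝔡.DNFBridge) : Prop48iv B := by
  obtain ⟨ι, κ, δ, hNF⟩ := B.isModel
  let H : 𝔡.DThetaNFHodgeTheater :=
    { J := B.J
      capsule := B.capsule
      glob := B.glob
      cod := 𝔡.tautStrip
      polyNF := B.poly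
      polyΘ := fun i v => 𝔡.phiThetaAt (ι.symm i) v (B.capsule i v) (𝔡.D v)
      isModel := ⟨ι, κ, δ, Iso.refl _, hNF, fun j v => by
        rw [Equiv.symm_apply_apply]
        exact phiThetaAt_eq_conj j v (Pi.isoApp (κ j) v) (Pi.isoApp (Iso.refl 𝔡.tautStrip) v)⟩ }
  refine ⟨H, ?_⟩
  cases B; rfl

end BaseThetaDatum

end Literature.IUT.HodgeTheaters
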